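import Literature.MathematicalPhysics.QuantumFieldTheory.BalabanImbrieJaffe1984to88.BIJ88Sect2Statements
import Literature.MathematicalPhysics.QuantumFieldTheory.BalabanImbrieJaffe1984to88.BIJ88Sect4Statements

/-!
# `BalabanImbrieJaffe1984to88.BIJ88Sect5Statements` — T. Bałaban, J. Imbrie, A. Jaffe, *Effective action and cluster
properties of the abelian Higgs model*, Commun. Math. Phys. **114** (1988) 257–315 [BalabanImbrieJaffe1988]: the
self-contained, kernel-checkable pieces of Sect. 5 "Renormalization and Decoupling in the General Step" (pp. 277–314)

statement-level skeleton of published theorems with citation tags; proofs where landed; nothing here is a claim about the Yang–Mills mass gap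

PDF held: `paper:balaban1988-cmp114-bij-abelian-higgs-effective-action` (journal page = PDF page + 256).  Renders read as images:
PDF pp. 21–58 (journal 277–314), CCITT-G4 → PNG ×2 with `run/shared/lean/pub/pub-balaban/b2b-balaban-ref1/tools/g4png.py`
(copies: the r16 seat folder `scratch/c2pages/original-pNNN-x2.png`).

CITATION HEADER (lean-in-tree rule).  Part of the lit-balaban TYPED SKELETON (HOME `run/shared/lean/pub/lit-balaban/`; rows
`C2.Eq5.1.1-5.1.4`, `C2.Eq5.2.1-5.2.4`, `C2.Eq5.2.5`, `C2.Eq5.6.6-5.6.12`, `C2.Eq5.11.2`, `C2.Eq5.13.1-5.13.2`, `C2.Eq5.13.3-5.13.4`,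
`C2.Eq5.15.1-5.15.2`, `C2.Eq5.15.3` of `HOME/lit-balaban-r16/ROWS-C2-part2.md`).  Sect. 5 of the paper contains NO numbered theorem, lemma or
proposition: it is one inductive construction ((5.1.1)–(5.15.4)) whose stated bounds involve the whole multi-scale machinery of
Sects. 2–4 and are inventoried as rows only.  WHAT IS REPRODUCED here, verbatim from the page images, are the pieces that are
given as definitions with bodies or finite algebraic identities: (5.1.2) the constant E^{(k)}; (5.2.3)–(5.2.4) the cutoff profile χ(1,·) (its
printed properties as the fields of a structure — an explicit hypothesis carrier, no existence claimed) and χ(p,x) = χ(1,x/p) with its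
support lemmas; (4.14)/(5.2.5) the leading potential P_k and its completed-square form — PROVED, with the printed cubic coefficient
`(2λ_k)^{1/2}` CORRECTED to `(2λ_k)^{1/2}(L^kε)` (the printed form is refuted by a kernel-checked instance, `eq525_asPrinted_false`);
(5.6.7) F₁ = e^{w} − 1 and (5.6.11) the resolvent expansion as a ring identity; (5.11.2)/(5.15.1) the Mayer expansion identity —
PROVED; p. 304 the elementary lower-bound step behind (5.13.2) — PROVED; (5.13) the interpolation expansion Δ_s = Σ_Γ … Δ_Γ —
PROVED; (5.15.3) the recursion of the normalizing energies ℰ_k with its closed form.  NOTHING else of the paper is asserted; in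
particular none of the bounds (5.4.7), (5.5.5), (5.6.13), (5.7.14), (5.9.3)–(5.9.5), (5.11.3), p. 307, (5.14.4), pp. 310–312 is typed
here.  Unit `lit-balaban-r16` (reader of C2 Sect. 5).

v1.1 (same unit): DOCFIX only — the quotations in `normE`, `normEnergy`, `F1`, `claim304_lower`, `interp_expand` re-read against the
page images and corrected to the printed sentences (pp. 277, 313, 287, 304, 305); no declaration added, removed or re-typed.  v1.2:
this header reflowed so that no docstring line begins with a declaration keyword (ref-3 `lint_cite` false positive «lemma `or` l.17»).  Companion module `BIJ88Sect5StatementsPart2` (the stated bounds of Sect. 5 as `Prop` leaves).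
v1.3 (gen 2; append-only, ref-2 I2 twin-family ask, bridges offered by r18 2026-08-21T01:01Z): the imports `BIJ88Sect2Statements`
and `BIJ88Sect4Statements` (r18; Sects. 2–4 of the same paper) replace `import Mathlib` (no cycle — neither file imports this one;
Mathlib stays available through them); cross-naming sentences added to the docstrings of `normE`, `lamK`, `Pk`; three kernel bridges
appended at the end — `lamK_eq_Sect2` ((2.2): r18's real-exponent typing = this file's integer-exponent typing at s = L^kε, no
positivity needed), `Pk_eq_Sect4` ((4.14) at λ_k = `lamK λ s d` and |φ| = ‖z‖ is (5.2.5)), `E0step_eq_card_mul_normE` ((3.12):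
E^{(0)} = |T₁^{(1)}|·E^{(k)} of (5.1.2) for d ≥ 2).  Companions `BIJ88Sect5StatementsPart3` (background-field thread of Sect. 5) and
`BIJ88Sect5StatementsPart4` (finite algebra of Sects. 5.6–5.14).  No existing declaration removed or re-typed.
v1.4 (gen 2; append-only): Sect. 5.15 p. 313 — the region Λ₁₃^{(k)} (`lam13`, with `lam13_subset`, `disjoint_lam13_of_mem`) and
the factorization **(5.15.2)** (`eq5152`, PROVED as a product split); (5.15.1) is `eq5112` read for W₆^{(k)}.  No existing
declaration removed or re-typed.
-/

open scoped ContDiff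

namespace Literature.MathematicalPhysics.QuantumFieldTheory.BalabanImbrieJaffe1984to88.BIJ88Sect5Statements

/-! ## (5.1.2) and (5.15.3): the normalization constants -/

/-- **(5.1.2)** p. 277 [PDF 21], verbatim: *"Here a ≈ 1 is fixed throughout, and the normalization is E^{(k)} = −log(aL^{d−2}/2π).
(5.1.2)"* — the constant in the exponent of the renormalization transformation (5.1.1); typed with an integer power so that every d
is covered (the paper has d = 2, 3).  Cross-naming (v1.3): the first-step constant **(3.12)** E^{(0)} = −|T₁^{(1)}| log(aL^{d−2}/2π) is
r18's `BIJ88Sect3Statements.E0step` (natural-number exponent); `E0step_eq_card_mul_normE` below: E^{(0)} = |T₁^{(1)}|·E^{(k)} for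
d ≥ 2. [cite: BalabanImbrieJaffe1988, (5.1.2) p.277] -/
noncomputable def normE (a L : ℝ) (d : ℕ) : ℝ :=
  -Real.log (a * L ^ ((d : ℤ) - 2) / (2 * Real.pi))

/-- **(5.15.3)** p. 313 [PDF 57], verbatim: *"Thus we define the (k+1)th normalizing energy to be ℰ_{k+1} = ℰ_k + E^{(k)} +
((d−2)/2)(log L)|T₁^{(k+1)}|. (5.15.3)"* — typed as the recursion k ↦ ℰ_k from a starting value ℰ₀, a sequence of constants E^{(k)}
and the volumes |T₁^{(k+1)}| (numbers of sites of the unit lattices). [cite: BalabanImbrieJaffe1988, (5.15.3) p.313] -/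
noncomputable def normEnergy (ℰ₀ : ℝ) (E vol : ℕ → ℝ) (d : ℕ) (L : ℝ) : ℕ → ℝ
  | 0 => ℰ₀
  | k + 1 => normEnergy ℰ₀ E vol d L k + E k + ((d : ℝ) - 2) / 2 * Real.log L * vol (k + 1)

/-- (5.15.3) as an equation. [cite: BalabanImbrieJaffe1988, (5.15.3) p.313] -/
theorem normEnergy_succ (ℰ₀ : ℝ) (E vol : ℕ → ℝ) (d : ℕ) (L : ℝ) (k : ℕ) :
    normEnergy ℰ₀ E vol d L (k + 1)
      = normEnergy ℰ₀ E vol d L k + E k + ((d : ℝ) - 2) / 2 * Real.log L * vol (k + 1) := rfl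

/-- The recursion (5.15.3) summed: ℰ_k = ℰ₀ + Σ_{j<k} (E^{(j)} + ((d−2)/2)(log L)|T₁^{(j+1)}|) (bookkeeping).
[cite: BalabanImbrieJaffe1988, (5.15.3) p.313] -/
theorem normEnergy_eq_sum (ℰ₀ : ℝ) (E vol : ℕ → ℝ) (d : ℕ) (L : ℝ) (k : ℕ) :
    normEnergy ℰ₀ E vol d L k
      = ℰ₀ + ∑ j ∈ Finset.range k, (E j + ((d : ℝ) - 2) / 2 * Real.log L * vol (j + 1)) := by
  induction k with
  | zero => simp [normEnergy]
  | succ k ih => rw [normEnergy_succ, ih, Finset.sum_range_succ]; ring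

/-! ## (5.2.3)–(5.2.4): the cutoff functions χ(p, x) -/

/-- **(5.2.3)** p. 278 [PDF 22], verbatim: *"We let χ(1,x) be an even, C^∞ function, equal to zero for |x| ≥ 1, and equal to one
for |x| ≤ 9/10, and with |dⁿχ(1,x)/dxⁿ| ≤ cⁿn^{cn} for all n, x. (5.2.3)"* — the printed properties of the profile χ(1,·) as the
fields of a structure (an explicit hypothesis carrier: the existence of such a profile, a Gevrey-class bump function, is NOT
asserted here). [cite: BalabanImbrieJaffe1988, (5.2.3) p.278] -/
structure CutoffProfile where
  /-- χ(1, ·) -/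
  χ₁ : ℝ → ℝ
  /-- "even" -/
  even : ∀ x, χ₁ (-x) = χ₁ x
  /-- "C^∞" -/
  smooth : ContDiff ℝ ∞ χ₁
  /-- "equal to zero for |x| ≥ 1" -/
  eq_zero : ∀ x, 1 ≤ |x| → χ₁ x = 0
  /-- "equal to one for |x| ≤ 9/10" -/
  eq_one : ∀ x, |x| ≤ 9 / 10 → χ₁ x = 1
  /-- "|dⁿχ(1,x)/dxⁿ| ≤ cⁿ n^{cn} for all n, x" -/
  deriv_bound : ∃ c : ℝ, ∀ (n : ℕ) (x : ℝ), |iteratedDeriv n χ₁ x| ≤ c ^ n * (n : ℝ) ^ (c * n)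

/-- **(5.2.4)** p. 278 [PDF 22], verbatim: *"Then we put χ(p, x) = χ(1, x/p). (5.2.4)"*.
[cite: BalabanImbrieJaffe1988, (5.2.4) p.278] -/
noncomputable def cutoff (χ : CutoffProfile) (p x : ℝ) : ℝ :=
  χ.χ₁ (x / p)

/-- p. 278 [PDF 22], verbatim: *"Here χ^c = 1 − χ"* (the complementary large-field functions of (5.2.1)–(5.2.2)).
[cite: BalabanImbrieJaffe1988, (5.2.2) p.278] -/
noncomputable def cutoffC (χ : CutoffProfile) (p x : ℝ) : ℝ :=
  1 - cutoff χ p x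

/-- χ(1, x) is the profile itself (unfolding of (5.2.4)). [cite: BalabanImbrieJaffe1988, (5.2.4) p.278] -/
theorem cutoff_one (χ : CutoffProfile) (x : ℝ) : cutoff χ 1 x = χ.χ₁ x := by
  simp [cutoff]

/-- χ(p, ·) is even (from "even" in (5.2.3)). [cite: BalabanImbrieJaffe1988, (5.2.3) p.278] -/
theorem cutoff_neg (χ : CutoffProfile) (p x : ℝ) : cutoff χ p (-x) = cutoff χ p x := by
  simp [cutoff, neg_div, χ.even]

/-- χ(p, x) = 0 for |x| ≥ p > 0 (the scaled support statement of (5.2.3)–(5.2.4)). [cite: BalabanImbrieJaffe1988, (5.2.4) p.278] -/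
theorem cutoff_eq_zero (χ : CutoffProfile) {p x : ℝ} (hp : 0 < p) (hx : p ≤ |x|) : cutoff χ p x = 0 := by
  refine χ.eq_zero _ ?_
  rw [abs_div, abs_of_pos hp, le_div_iff₀ hp, one_mul]
  exact hx

/-- χ(p, x) = 1 for |x| ≤ (9/10)p, p > 0 (the scaled plateau statement of (5.2.3)–(5.2.4)).
[cite: BalabanImbrieJaffe1988, (5.2.4) p.278] -/
theorem cutoff_eq_one (χ : CutoffProfile) {p x : ℝ} (hp : 0 < p) (hx : |x| ≤ 9 / 10 * p) : cutoff χ p x = 1 := by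
  refine χ.eq_one _ ?_
  rw [abs_div, abs_of_pos hp, div_le_iff₀ hp]
  exact hx

/-- Consequently χ^c(p, x) = 1 on the large-field set |x| ≥ p. [cite: BalabanImbrieJaffe1988, (5.2.2) p.278] -/
theorem cutoffC_eq_one (χ : CutoffProfile) {p x : ℝ} (hp : 0 < p) (hx : p ≤ |x|) : cutoffC χ p x = 1 := by
  simp [cutoffC, cutoff_eq_zero χ hp hx]

/-! ## (4.14)/(5.2.5): the leading potential P_k and its completed square -/

/-- **(2.2)** p. 260 (= (3.9) p. 266), verbatim: *"λ_k = (L^kε)^{4−d}λ"* — the running quartic coupling, as a function of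
s = L^kε > 0 (integer power, all d).  Cross-naming (v1.3): the same printed quantity is r18's `BIJ88Sect2Statements.lamK L ε λ d k`
((2.2), real exponent); `lamK_eq_Sect2` below proves the two typings agree at `s = L^kε`. [cite: BalabanImbrieJaffe1988, (2.2) p.260] -/
noncomputable def lamK (lam s : ℝ) (d : ℕ) : ℝ :=
  s ^ ((4 : ℤ) - d) * lam

/-- **(5.2.5)** first line, p. 278 [PDF 22] (= (4.14) p. 276), verbatim: *"P_k(φ) = λ_k|φ|⁴ − ¼(L^kε)²|φ|² + (1/64λ)(L^kε)^d"*
— as a function of r = |φ| and s = L^kε.  Cross-naming (v1.3): r18's `BIJ88Sect4Statements.Pk λ_k s λ d z` ((4.14), complex field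
value `z`, λ_k a parameter) at `λ_k = lamK λ s d` equals `Pk λ s d ‖z‖` (`Pk_eq_Sect4` below). [cite: BalabanImbrieJaffe1988, (5.2.5) p.278] -/
noncomputable def Pk (lam s : ℝ) (d : ℕ) (r : ℝ) : ℝ :=
  lamK lam s d * r ^ 4 - 1 / 4 * s ^ 2 * r ^ 2 + 1 / (64 * lam) * s ^ d

/-- **(5.2.5)** p. 278 [PDF 22], verbatim: *"where ρ₀ = (8λ)^{−1/2}(L^kε)^{(d−2)/2}"* — typed as √((L^kε)^{d−2}/(8λ)).
[cite: BalabanImbrieJaffe1988, (5.2.5) p.278] -/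
noncomputable def rho0 (lam s : ℝ) (d : ℕ) : ℝ :=
  Real.sqrt (s ^ ((d : ℤ) - 2) / (8 * lam))

/-- ρ₀² = (L^kε)^{d−2}/(8λ). [cite: BalabanImbrieJaffe1988, (5.2.5) p.278] -/
theorem rho0_sq {lam s : ℝ} (hlam : 0 < lam) (hs : 0 < s) (d : ℕ) :
    rho0 lam s d ^ 2 = s ^ ((d : ℤ) - 2) / (8 * lam) := by
  unfold rho0
  exact Real.sq_sqrt (by positivity)

/-- The first relation behind (5.2.5): λ_kρ₀² = (L^kε)²/8 (from λ_k = s^{4−d}λ and ρ₀² = s^{d−2}/(8λ)).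
[cite: BalabanImbrieJaffe1988, (5.2.5) p.278] -/
theorem lamK_mul_rho0_sq {lam s : ℝ} (hlam : 0 < lam) (hs : 0 < s) (d : ℕ) :
    lamK lam s d * rho0 lam s d ^ 2 = s ^ 2 / 8 := by
  rw [rho0_sq hlam hs, lamK]
  have hprod : s ^ ((4 : ℤ) - d) * s ^ ((d : ℤ) - 2) = s ^ 2 := by
    rw [← zpow_add₀ hs.ne', show (4 : ℤ) - d + ((d : ℤ) - 2) = 2 by ring, zpow_two, pow_two]
  have hre : s ^ ((4 : ℤ) - d) * lam * (s ^ ((d : ℤ) - 2) / (8 * lam))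
      = s ^ ((4 : ℤ) - d) * s ^ ((d : ℤ) - 2) / 8 * (lam / lam) := by ring
  rw [hre, hprod, div_self hlam.ne', mul_one]

/-- The second relation behind (5.2.5): (2λ_k)^{1/2}ρ₀ = (L^kε)/2. [cite: BalabanImbrieJaffe1988, (5.2.5) p.278] -/
theorem sqrt_two_lamK_mul_rho0 {lam s : ℝ} (hlam : 0 < lam) (hs : 0 < s) (d : ℕ) :
    Real.sqrt (2 * lamK lam s d) * rho0 lam s d = s / 2 := by
  have hlk : 0 ≤ 2 * lamK lam s d := by unfold lamK; positivity
  have hρ : 0 ≤ rho0 lam s d := Real.sqrt_nonneg _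
  rw [← Real.sqrt_sq hρ, ← Real.sqrt_mul hlk, show 2 * lamK lam s d * rho0 lam s d ^ 2 = (s / 2) ^ 2 by
    rw [mul_assoc, lamK_mul_rho0_sq hlam hs]; ring]
  exact Real.sqrt_sq (by positivity)

/-- The constant term of (5.2.5): (1/64λ)(L^kε)^d = λ_kρ₀⁴. [cite: BalabanImbrieJaffe1988, (5.2.5) p.278] -/
theorem const_eq_lamK_mul_rho0_pow_four {lam s : ℝ} (hlam : 0 < lam) (hs : 0 < s) (d : ℕ) :
    1 / (64 * lam) * s ^ d = lamK lam s d * rho0 lam s d ^ 4 := by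
  rw [show rho0 lam s d ^ 4 = rho0 lam s d ^ 2 * rho0 lam s d ^ 2 by ring, ← mul_assoc,
    lamK_mul_rho0_sq hlam hs, rho0_sq hlam hs]
  have hs0 : s ≠ 0 := hs.ne'
  have hsd : (s ^ d : ℝ) = s ^ 2 * s ^ ((d : ℤ) - 2) := by
    rw [← zpow_natCast, zpow_sub₀ hs0, zpow_natCast, zpow_two, pow_two]
    field_simp
  rw [hsd]
  ring

/-- **(5.2.5)** p. 278 [PDF 22] — the completed-square form of the leading potential, PROVED.  Verbatim print: *"P_k(φ) =
λ_k|φ|⁴ − ¼(L^kε)²|φ|² + (1/64λ)(L^kε)^d = λ_k(|φ|−ρ₀)⁴ + (2λ_k)^{1/2}(|φ|−ρ₀)³ + ½(L^kε)²(|φ|−ρ₀)², where ρ₀ =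
(8λ)^{−1/2}(L^kε)^{(d−2)/2}. (5.2.5)"*.  DIVERGENCE (print defect, recorded not adjudicated): the identity holds exactly iff the
cubic coefficient reads `(2λ_k)^{1/2}(L^kε)`; as printed (without the factor L^kε) it is false for L^kε ≠ 1
(`eq525_asPrinted_false`).  Typed with the factor restored; r = |φ| ranges over ℝ, s = L^kε > 0, λ > 0, any d.
[cite: BalabanImbrieJaffe1988, (5.2.5) p.278] -/
theorem eq525 {lam s : ℝ} (hlam : 0 < lam) (hs : 0 < s) (d : ℕ) (r : ℝ) :
    Pk lam s d r
      = lamK lam s d * (r - rho0 lam s d) ^ 4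
        + Real.sqrt (2 * lamK lam s d) * s * (r - rho0 lam s d) ^ 3
        + 1 / 2 * s ^ 2 * (r - rho0 lam s d) ^ 2 := by
  have h1 := lamK_mul_rho0_sq hlam hs d
  have h2 : Real.sqrt (2 * lamK lam s d) * s = 4 * lamK lam s d * rho0 lam s d := by
    have ht2 : Real.sqrt (2 * lamK lam s d) ^ 2 = 2 * lamK lam s d :=
      Real.sq_sqrt (by unfold lamK; positivity)
    have := sqrt_two_lamK_mul_rho0 hlam hs d
    linear_combination (-2 : ℝ) * Real.sqrt (2 * lamK lam s d) * this + 2 * rho0 lam s d * ht2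
  have h3 := const_eq_lamK_mul_rho0_pow_four hlam hs d
  unfold Pk
  rw [h3]
  linear_combination ((2 : ℝ) * r ^ 2 + 4 * (r - rho0 lam s d) ^ 2) * h1 + (-(r - rho0 lam s d) ^ 3) * h2

/-- (5.2.5) says P_k is a perfect square: P_k(r) = λ_k(r² − ρ₀²)² (hence P_k ≥ 0 with its minimum 0 at r = ρ₀, the fact used on
p. 279: "for |φ(x)| in the support of χ^c_x, P_k(φ(x)) ≥ O(p(e_k)²)"). [cite: BalabanImbrieJaffe1988, (5.2.5) p.278] -/
theorem Pk_eq_sq {lam s : ℝ} (hlam : 0 < lam) (hs : 0 < s) (d : ℕ) (r : ℝ) :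
    Pk lam s d r = lamK lam s d * (r ^ 2 - rho0 lam s d ^ 2) ^ 2 := by
  have h1 := lamK_mul_rho0_sq hlam hs d
  have h3 := const_eq_lamK_mul_rho0_pow_four hlam hs d
  unfold Pk
  rw [h3]
  linear_combination ((2 : ℝ) * r ^ 2) * h1

/-- P_k ≥ 0. [cite: BalabanImbrieJaffe1988, (5.2.5) p.278] -/
theorem Pk_nonneg {lam s : ℝ} (hlam : 0 < lam) (hs : 0 < s) (d : ℕ) (r : ℝ) : 0 ≤ Pk lam s d r := by
  rw [Pk_eq_sq hlam hs]
  unfold lamK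
  positivity

/-- The identity (5.2.5) AS PRINTED (cubic coefficient `(2λ_k)^{1/2}` without the factor L^kε) is false: at d = 2, λ = 1/2,
L^kε = 2, |φ| = 0 one has λ_k = 2, ρ₀ = 1/2, (2λ_k)^{1/2} = 2, P_k = 1/8 but the printed right side is 3/8 (kernel witness of the
print defect recorded in `eq525`). [cite: BalabanImbrieJaffe1988, (5.2.5) p.278] -/
theorem eq525_asPrinted_false :
    ¬ ∀ (lam s : ℝ) (d : ℕ) (r : ℝ), 0 < lam → 0 < s →
      Pk lam s d r
        = lamK lam s d * (r - rho0 lam s d) ^ 4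
          + Real.sqrt (2 * lamK lam s d) * (r - rho0 lam s d) ^ 3
          + 1 / 2 * s ^ 2 * (r - rho0 lam s d) ^ 2 := by
  intro h
  have h' := h (1 / 2) 2 2 0 (by norm_num) (by norm_num)
  have hl : lamK (1 / 2) 2 2 = 2 := by norm_num [lamK]
  have hρ : rho0 (1 / 2) 2 2 = 1 / 2 := by
    rw [rho0, show ((2 : ℝ) ^ (((2 : ℕ) : ℤ) - 2) / (8 * (1 / 2))) = (1 / 2) ^ 2 by norm_num]
    exact Real.sqrt_sq (by norm_num)
  have h4 : Real.sqrt (2 * 2) = 2 := by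
    rw [show (2 : ℝ) * 2 = 2 ^ 2 by norm_num]
    exact Real.sqrt_sq (by norm_num)
  rw [hl, hρ, h4, Pk, hl] at h'
  norm_num at h'

/-! ## (5.6.7) and (5.6.11): the expansion functions and the resolvent expansion -/

/-- **(5.6.7)** p. 287 [PDF 31], verbatim: *"We have with ζ = L^{−j}, Ã scaled to the ζ-lattice, ũ_{k+1}ũ = ũ_{k+1}(1 + Σ_{n=1}^∞
(ie_jζÃ)ⁿ/n!) = ũ_{k+1}(1 + F_{1,j}(Ã)). (5.6.7)"* — as a function of the combination w = ie_jζÃ_b: F₁(w) = e^{w} − 1 (the series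
Σ_{n≥1} wⁿ/n!). [cite: BalabanImbrieJaffe1988, (5.6.7) p.287] -/
noncomputable def F1 (w : ℂ) : ℂ :=
  Complex.exp w - 1

/-- 1 + F₁(w) = e^{w} ((5.6.6)–(5.6.7)). [cite: BalabanImbrieJaffe1988, (5.6.7) p.287] -/
theorem one_add_F1 (w : ℂ) : 1 + F1 w = Complex.exp w := by
  simp [F1]

/-- F₁ is first order small: ‖F₁(w)‖ ≤ 2‖w‖ for ‖w‖ ≤ 1 (the sense of "terms in V_j are small" after (5.6.11); Mathlib's
`Complex.norm_exp_sub_one_le`). [cite: BalabanImbrieJaffe1988, (5.6.7) p.287] -/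
theorem norm_F1_le {w : ℂ} (hw : ‖w‖ ≤ 1) : ‖F1 w‖ ≤ 2 * ‖w‖ :=
  Complex.norm_exp_sub_one_le hw

/-- **(5.6.11)** p. 287 [PDF 31], verbatim: *"G_j(Ω, ũ_{k+1}ũ) = G_j(Ω, ũ_{k+1}) + G_j(Ω, ũ_{k+1})V_jG_j(Ω, ũ_{k+1}ũ)"*, where by
(5.6.10) the operator inverted by G_j(Ω, ũ_{k+1}ũ) is [the operator inverted by G_j(Ω, ũ_{k+1})] − V_j(Ω).  Typed as the ring identity
it is: g₀a = 1 and (a − v)g = 1 imply g = g₀ + g₀vg. [cite: BalabanImbrieJaffe1988, (5.6.11) p.287] -/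
theorem eq5611 {R : Type*} [Ring R] {a v g₀ g : R} (h₀ : g₀ * a = 1) (h : (a - v) * g = 1) :
    g = g₀ + g₀ * v * g := by
  have hag : a * g = 1 + v * g := by
    rw [sub_mul] at h
    exact sub_eq_iff_eq_add.mp h
  calc g = g₀ * a * g := by rw [h₀, one_mul]
    _ = g₀ * (a * g) := by rw [mul_assoc]
    _ = g₀ + g₀ * v * g := by rw [hag, mul_add, mul_one, mul_assoc]

/-! ## (5.11.2)/(5.15.1): the Mayer expansion identity -/

/-- **(5.11.2)** p. 299 [PDF 43], verbatim: *"exp(−Σ_X W₄^{(k)}(X)) = Σ_{S₄} Π_{(j,x_j,X)∈S₄} (e^{−W^{(k)}_{4,j}(x_j,X)} − 1), (5.11.2)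
where S₄ runs over subsets of S̃₄, the set of all triplets (j, x_j, X)"*; the same identity is (5.15.1) p. 312 for W₆^{(k)} and the
Mayer step of Sect. 5.13 p. 304.  Typed over an arbitrary finite index set of "polymers". [cite: BalabanImbrieJaffe1988, (5.11.2) p.299] -/
theorem eq5112 {α : Type*} (𝒳 : Finset α) (W : α → ℝ) :
    Real.exp (-∑ X ∈ 𝒳, W X) = ∑ S ∈ 𝒳.powerset, ∏ X ∈ S, (Real.exp (-W X) - 1) := by
  rw [← Finset.sum_neg_distrib, Real.exp_sum, ← Finset.prod_one_add]
  exact Finset.prod_congr rfl fun X _ => by ring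

/-- p. 299: *"Since e^{−W} − 1 satisfies the same bound as W (5.11.1)"* — the elementary inequality behind it, in Mathlib's form
|e^{−w} − 1| ≤ 2|w| for |w| ≤ 1. [cite: BalabanImbrieJaffe1988, (5.11.2) p.299] -/
theorem abs_exp_neg_sub_one_le {w : ℝ} (hw : |w| ≤ 1) : |Real.exp (-w) - 1| ≤ 2 * |w| := by
  have := Real.abs_exp_sub_one_le (x := -w) (by simpa using hw)
  simpa using this

/-! ## p. 304 and (5.13): the decoupling step — lower bound and interpolation of the covariance -/

/-- p. 304 [PDF 48], verbatim: *"Thus we have a new quadratic form for Λ₁₀^{(k)c*c}A^{(k)″}, namely Q*Q + (I − Q*Q^s)∂*σ_{k,loc}∂(I −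
Q^{s*}Q). (5.13.2) This is still bounded below on the subspace determined by δ_Ax(A^{(k)″}): our lower bound on ∂*σ_{k,loc}∂ implies a
lower bound ‖QA^{(k)″}‖² + O(1)‖A^{(k)″} − Q^{s*}QA^{(k)″}‖² ≥ O(1)‖A^{(k)″}‖²."* — the elementary step behind the last inequality,
PROVED for any maps Q : E → F, Q^{s*} : F → E between seminormed groups with ‖Q^{s*}y‖ ≤ M‖y‖ (no sign needed on M): ‖A‖² ≤
2M²‖QA‖² + 2‖A − Q^{s*}QA‖².  (v1.1 DOCFIX: quotation corrected to the printed wording; statement and proof unchanged.)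
[cite: BalabanImbrieJaffe1988, (5.13.2) p.304] -/
theorem claim304_lower {E F : Type*} [SeminormedAddCommGroup E] [SeminormedAddCommGroup F] (Q : E → F) (Qs : F → E)
    {M : ℝ} (hQs : ∀ y, ‖Qs y‖ ≤ M * ‖y‖) (A : E) :
    ‖A‖ ^ 2 ≤ 2 * M ^ 2 * ‖Q A‖ ^ 2 + 2 * ‖A - Qs (Q A)‖ ^ 2 := by
  have htri : ‖A‖ ≤ M * ‖Q A‖ + ‖A - Qs (Q A)‖ := by
    calc ‖A‖ = ‖Qs (Q A) + (A - Qs (Q A))‖ := by rw [add_sub_cancel]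
      _ ≤ ‖Qs (Q A)‖ + ‖A - Qs (Q A)‖ := norm_add_le _ _
      _ ≤ M * ‖Q A‖ + ‖A - Qs (Q A)‖ := add_le_add (hQs _) le_rfl
  have hA2 : ‖A‖ ^ 2 ≤ (M * ‖Q A‖ + ‖A - Qs (Q A)‖) ^ 2 := by
    rw [sq, sq]
    exact mul_self_le_mul_self (norm_nonneg A) htri
  nlinarith [hA2, sq_nonneg (M * ‖Q A‖ - ‖A - Qs (Q A)‖)]

/-- **Sect. 5.13** p. 305 [PDF 49], verbatim: *"Next we define an operation a_ΓΔ_{Γ′} = Δ_{Γ∪Γ′}, and we define a quadratic form for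
s = {s_i}_{i∈I}: Δ_s = Π_{i∈I} [(1 − s_i)a_i + s_i] Δ = Σ_{Γ⊂I} Π_{i∈Γ} (1 − s_i) Π_{i∈I∖Γ} s_i Δ_Γ."* (Δ_Γ the Dirichlet forms of
p. 305, Δ_∅ = Δ; the a_i commute and a_Γ = Π_{i∈Γ} a_i) — the expansion of the interpolating product, PROVED in any commutative ring
containing the parameters s_i and the operations a_i (Δ_Γ ↔ Π_{i∈Γ} a_i). [cite: BalabanImbrieJaffe1988, (5.13.3) p.305] -/
theorem interp_expand {ι R : Type*} [CommRing R] [DecidableEq ι] (I : Finset ι) (s a : ι → R) :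
    ∏ i ∈ I, ((1 - s i) * a i + s i)
      = ∑ Γ ∈ I.powerset, (∏ i ∈ Γ, (1 - s i)) * (∏ i ∈ I \ Γ, s i) * ∏ i ∈ Γ, a i := by
  rw [Finset.prod_add]
  refine Finset.sum_congr rfl fun Γ _ => ?_
  rw [Finset.prod_mul_distrib]
  ring

/-- At s ≡ 1 the interpolation is trivial: Δ_{s=1} = Δ (all cubes coupled), the t = 1 end of the fundamental-theorem-of-calculus
expansion (5.13.3). [cite: BalabanImbrieJaffe1988, (5.13.3) p.305] -/
theorem interp_at_one {ι R : Type*} [CommRing R] (I : Finset ι) (a : ι → R) :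
    ∏ i ∈ I, ((1 - (1 : R)) * a i + 1) = 1 := by
  simp

/-- At s ≡ 0: Δ_{s=0} = Δ_I = (Π_{i∈I} a_i)Δ (all cubes decoupled). [cite: BalabanImbrieJaffe1988, (5.13.3) p.305] -/
theorem interp_at_zero {ι R : Type*} [CommRing R] (I : Finset ι) (a : ι → R) :
    ∏ i ∈ I, ((1 - (0 : R)) * a i + 0) = ∏ i ∈ I, a i := by
  simp

/-! ## v1.3: cross-naming bridges (ref-2 I2) — the running coupling `λ_k`, the dominant term `P_k` and the normalization
constant `E^{(k)}` across the C2 files of this folder (r18's `BIJ88Sect2Statements` / `BIJ88Sect3Statements` /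
`BIJ88Sect4Statements` ↔ this file) -/

/-- kernel (dictionary, ref-2 I2 twin-family note): r18's `BIJ88Sect2Statements.lamK L ε λ d k` (**(2.2)** p. 260, verbatim
*"λ_k = (L^kε)^{4−d}λ"*, typed with a real exponent) IS this file's `lamK λ (L^kε) d` ((2.2) = (3.9), integer exponent) — the same
printed quantity, two typings; no positivity hypothesis is needed (`Real.rpow_intCast`). [cite: BalabanImbrieJaffe1988, (2.2) p.260] -/
theorem lamK_eq_Sect2 (L ε lam : ℝ) (d k : ℕ) :
    BIJ88Sect2Statements.lamK L ε lam d k = lamK lam (L ^ k * ε) d := by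
  unfold BIJ88Sect2Statements.lamK lamK
  rw [show (4 - (d : ℝ)) = (((4 : ℤ) - d : ℤ) : ℝ) by push_cast; ring, Real.rpow_intCast]

/-- kernel (dictionary, ref-2 I2): r18's `BIJ88Sect4Statements.Pk λ_k s λ d z` (**(4.14)** p. 276, verbatim *"P_k(φ) = λ_k|φ|⁴ −
¼(L^kε)²|φ|² + (1/64λ)(L^kε)^d"*, complex field value `z`, `λ_k` a free parameter) at `λ_k = lamK λ s d` IS this file's
`Pk λ s d ‖z‖` (**(5.2.5)** p. 278, radial variable r = |φ|) — the same printed polynomial. [cite: BalabanImbrieJaffe1988, (5.2.5) p.278] -/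
theorem Pk_eq_Sect4 (lam s : ℝ) (d : ℕ) (z : ℂ) :
    BIJ88Sect4Statements.Pk (lamK lam s d) s lam d z = Pk lam s d ‖z‖ := by
  simp only [BIJ88Sect4Statements.Pk, Pk]

/-- kernel (dictionary; statement and proof supplied by r18, 2026-08-21T01:01Z): r18's first-step constant
`BIJ88Sect3Statements.E0step n a L d` (**(3.12)** p. 267, verbatim *"E^{(0)} = −|T₁^{(1)}| log(aL^{d−2}/2π)"*, `n` = |T₁^{(1)}|,
natural-number exponent) equals `n · normE a L d` (**(5.1.2)** p. 277, *"E^{(k)} = −log(aL^{d−2}/2π)"*, integer exponent) for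
d ≥ 2 — the general-step constant is the per-site first-step constant. [cite: BalabanImbrieJaffe1988, (3.12) p.267; (5.1.2) p.277] -/
theorem E0step_eq_card_mul_normE (n : ℕ) (a L : ℝ) {d : ℕ} (hd : 2 ≤ d) :
    BIJ88Sect3Statements.E0step n a L d = n * normE a L d := by
  unfold BIJ88Sect3Statements.E0step normE
  rw [show ((d : ℤ) - 2) = ((d - 2 : ℕ) : ℤ) by omega, zpow_natCast]
  ring

/-! ## v1.4: Sect. 5.15 p. 313 — the region `Λ₁₃^{(k)}` and the factorization (5.15.2) (row C2.Eq5.15.1-5.15.2;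
(5.15.1) is `eq5112` read for `W₆^{(k)}`) -/

section Sect515

variable {S : Type*} [DecidableEq S]

/-- **p. 313 [PDF 57], the region Λ₁₃^{(k)}**, verbatim: *"We define Λ₁₃^{(k)} = Λ₁₂^{(k)} ∖ ⋃_{X∈S₆} X ∖ ⋃_{r′} X_{r′} ∖
⋃_{c : X_c∩X ≠ ∅, X∈S₆} X_c; it is a region now completely free of irrelevant terms."* — over finite sets of sites: `Λ12` =
Λ₁₂^{(k)}, `S6` = the Mayer family S₆ of (5.15.1), `Xr` = the remainder components {X_{r′}} of (5.14.5), `Xc` = the components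
{X_c}; the last union runs over the X_c meeting some X ∈ S₆. [cite: BalabanImbrieJaffe1988, Sect. 5.15 p.313 (before (5.15.2))] -/
def lam13 (Λ12 : Finset S) (S6 Xr Xc : Finset (Finset S)) : Finset S :=
  ((Λ12 \ S6.biUnion id) \ Xr.biUnion id) \
    (Xc.filter fun Y => ∃ X ∈ S6, (Y ∩ X).Nonempty).biUnion id

/-- kernel: Λ₁₃^{(k)} ⊆ Λ₁₂^{(k)} (three deletions). [cite: BalabanImbrieJaffe1988, Sect. 5.15 p.313] -/
theorem lam13_subset (Λ12 : Finset S) (S6 Xr Xc : Finset (Finset S)) :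
    lam13 Λ12 S6 Xr Xc ⊆ Λ12 :=
  (Finset.sdiff_subset.trans Finset.sdiff_subset).trans Finset.sdiff_subset

/-- kernel: no site of a Mayer polymer X ∈ S₆ lies in Λ₁₃^{(k)} (*"completely free of irrelevant terms"*).
[cite: BalabanImbrieJaffe1988, Sect. 5.15 p.313] -/
theorem disjoint_lam13_of_mem (Λ12 : Finset S) {S6 : Finset (Finset S)} (Xr Xc : Finset (Finset S))
    {X : Finset S} (hX : X ∈ S6) : Disjoint (lam13 Λ12 S6 Xr Xc) X := by
  unfold lam13
  refine Finset.disjoint_left.mpr fun y hy hyX => ?_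
  simp only [Finset.mem_sdiff, Finset.mem_biUnion, id, not_exists, not_and] at hy
  exact hy.1.1.2 X hX hyX

/-- **(5.15.2)** p. 313 [PDF 57], verbatim: *"We write Π_{c : X_c ⊄ ⋃_{r′}X_{r′}} F^L_{k+1,loc}(X_c) = Π_{c′} F^L_{k+1,loc}(X_{c′})
Π_{σ′} F^L_{k+1,loc}(X_{σ′}), (5.15.2) where {σ′} = {c : X_c ⊂ Λ₁₃^{(k)}}, and {c′} are the rest."* — PROVED as the splitting
of a finite product along the predicate `X_c ⊆ Λ₁₃^{(k)}`: `C` = the printed index set {c : X_c ⊄ ⋃_{r′}X_{r′}} (any finite set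
of components), `X c` = X_c, `F c` = F^L_{k+1,loc}(X_c) in a commutative monoid, `Λ13` = `lam13 …` (any finite set).
[cite: BalabanImbrieJaffe1988, (5.15.2) p.313] -/
theorem eq5152 {ι M : Type*} [CommMonoid M] (C : Finset ι) (X : ι → Finset S) (F : ι → M) (Λ13 : Finset S) :
    ∏ c ∈ C, F c = (∏ c ∈ C.filter fun c => ¬ X c ⊆ Λ13, F c) * ∏ c ∈ C.filter fun c => X c ⊆ Λ13, F c := by
  rw [mul_comm]
  exact (Finset.prod_filter_mul_prod_filter_not C (fun c => X c ⊆ Λ13) F).symm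

end Sect515

end Literature.MathematicalPhysics.QuantumFieldTheory.BalabanImbrieJaffe1984to88.BIJ88Sect5Statements
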